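import Mathlib
import HarnessLib
import Literature.MathematicalPhysics.QuantumFieldTheory.CircleHaarAngle
import Summits.Ventures.LatticeQCDFlow.Exactness.CompactHaar

/-!
# One exponential kick of a Lebesgue-minorised momentum is `(2π/ε) ·` Haar measure on `U(1)`

HONEST FRAMING: exact (Metropolis-corrected) sampling algorithms for lattice gauge theory;
figures of merit are autocorrelation/cost numbers at stated couplings and volumes; no
continuum-physics claim.

Venture `LatticeQCDFlow` (cell pub-lqcd), topic `Exactness`, FANOUT row 9 (eng-latcore, the
engine `latflow.core`: the `U(1)` link drift `θ ← θ + ε p` / `V ← e^{iεp} V` of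
`u1_2d.U1Field2D.hmc_trajectory` and of family B's `latflow.fthmc` on the `U(1)` rung).  NEW WORK of
the cell over Mathlib and the tree; nothing here is cited as a fact.  The angle picture of Haar
measure on `U(1)` is IMPORTED BY NAME from the literature support file `CircleHaarAngle`
(`CircleHaar.map_exp_angleMeasure`: `((2π)⁻¹ dθ on (−π, π]) ∘ exp⁻¹ = Haar`); nothing of it is
re-proved.  The `U(1)` twin of `SU2ExpChartMinorisation.lean` — here the chart inequality is an
EQUALITY (the Haar density in the angle chart is constant):

* `smul_haarProbability_circle_eq_map_exp` — `2π • Haar_{U(1)} = (dθ|_{|θ|<π}) ∘ exp⁻¹`;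
* `map_mul_restrict_ball_real` — Lebesgue scaling of an interval; `smul_haarProbability_circle_le_map_exp_mul`
  — with a step size `ε > 0`, `(2π/ε) • Haar ≤ (dθ|_{|θ|<π/ε}) ∘ (θ ↦ e^{iεθ})⁻¹` (an equality, stated as
  the inequality the Doeblin argument consumes);
* `map_add_left_restrict_ball_real`, `restrict_ball_le_map_add_left_real` — a kick `v` with
  `π/ε + |v| ≤ R` keeps the injectivity interval inside the ball of radius `R`;
  **`smul_haarProbability_circle_le_map_kickDrift`** — for every link value `u ∈ U(1)`,
  `(2π/ε) • Haar ≤ (dθ|_{|θ|<R}) ∘ (θ ↦ e^{iε(v+θ)}·u)⁻¹`;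
* `continuous_circleKickDrift` / `measurable_circleKickDrift`.
-/

noncomputable section

namespace Summit.Ventures.LatticeQCDFlow.Exactness

open MeasureTheory Measure Set Metric
open Literature.MathematicalPhysics.QuantumFieldTheory (haarProbability)
open Literature.MathematicalPhysics.QuantumFieldTheory.CircleHaar (angleMeasure map_exp_angleMeasure
  ofReal_two_pi_ne_zero)
open scoped ENNReal

/-! ## §1 Haar measure on `U(1)` is `(2π)⁻¹ ×` Lebesgue on `(−π, π)` pushed by `θ ↦ e^{iθ}` -/

/-- **`2π • Haar_{U(1)} = (dθ on the ball `|θ| < π`) pushed through `θ ↦ e^{iθ}`** (the endpoint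
`θ = π` of the literature's half-open window is Lebesgue-null). -/
theorem smul_haarProbability_circle_eq_map_exp :
    ENNReal.ofReal (2 * Real.pi) • haarProbability Circle =
      (volume.restrict (ball (0 : ℝ) Real.pi)).map Circle.exp := by
  have hball : ball (0 : ℝ) Real.pi = Ioo (-Real.pi) Real.pi := by
    rw [Real.ball_eq_Ioo, zero_sub, zero_add]
  rw [← map_exp_angleMeasure, angleMeasure, Measure.map_smul, smul_smul,
    ENNReal.mul_inv_cancel ofReal_two_pi_ne_zero ENNReal.ofReal_ne_top, one_smul, hball,
    Measure.restrict_congr_set Ioo_ae_eq_Ioc]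

/-! ## §2 A step size: Lebesgue scaling of the interval -/

/-- Lebesgue scaling on the line: `(dθ|_{|θ|<R}) ∘ (ε ·)⁻¹ = ε⁻¹ · dθ|_{|θ|<εR}` for `ε > 0`. -/
theorem map_mul_restrict_ball_real {ε : ℝ} (hε : 0 < ε) (R : ℝ) :
    (volume.restrict (ball (0 : ℝ) R)).map (fun θ : ℝ => ε * θ) =
      ENNReal.ofReal (ε⁻¹) • volume.restrict (ball (0 : ℝ) (ε * R)) := by
  have hpre : (fun θ : ℝ => ε * θ) ⁻¹' ball 0 (ε * R) = ball 0 R := by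
    ext θ
    simp only [mem_preimage, mem_ball_zero_iff, Real.norm_eq_abs, abs_mul, abs_of_pos hε]
    exact ⟨fun h => lt_of_mul_lt_mul_left h hε.le, fun h => mul_lt_mul_of_pos_left h hε⟩
  rw [← hpre, ← Measure.restrict_map (measurable_const_mul ε) measurableSet_ball,
    Real.map_volume_mul_left hε.ne', Measure.restrict_smul, abs_inv, abs_of_pos hε]

/-- **With a step size**: `(2π/ε) • Haar ≤ (dθ|_{|θ|<π/ε}) ∘ (θ ↦ e^{iεθ})⁻¹` for `ε > 0`. -/
theorem smul_haarProbability_circle_le_map_exp_mul {ε : ℝ} (hε : 0 < ε) :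
    ENNReal.ofReal (2 * Real.pi / ε) • haarProbability Circle ≤
      (volume.restrict (ball (0 : ℝ) (Real.pi / ε))).map (fun θ : ℝ => Circle.exp (ε * θ)) := by
  have hcomp : (fun θ : ℝ => Circle.exp (ε * θ)) = Circle.exp ∘ fun θ : ℝ => ε * θ := rfl
  rw [hcomp, ← Measure.map_map Circle.exp.continuous.measurable (measurable_const_mul ε),
    map_mul_restrict_ball_real hε, show ε * (Real.pi / ε) = Real.pi by field_simp, Measure.map_smul,
    ← smul_haarProbability_circle_eq_map_exp, smul_smul, ← ENNReal.ofReal_mul (inv_pos.2 hε).le,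
    ← div_eq_inv_mul]

/-! ## §3 A bounded kick before the drift, and the frozen link value after it -/

/-- Translating Lebesgue measure on an interval translates the interval. -/
theorem map_add_left_restrict_ball_real (v R : ℝ) :
    (volume.restrict (ball (0 : ℝ) R)).map (fun θ : ℝ => v + θ) = volume.restrict (ball v R) := by
  have hpre : (fun θ : ℝ => v + θ) ⁻¹' ball v R = ball 0 R := by
    ext θ
    simp [mem_ball, dist_eq_norm]
  rw [← hpre, ← Measure.restrict_map (measurable_const_add v) measurableSet_ball, map_add_left_eq_self]

/-- **A bounded kick does not lose the injectivity interval**: if `r + |v| ≤ R` then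
`dθ|_{|θ|<r} ≤ (dθ|_{|θ|<R}) ∘ (v + ·)⁻¹`. -/
theorem restrict_ball_le_map_add_left_real {v r R : ℝ} (h : r + ‖v‖ ≤ R) :
    volume.restrict (ball (0 : ℝ) r) ≤ (volume.restrict (ball (0 : ℝ) R)).map (fun θ : ℝ => v + θ) := by
  rw [map_add_left_restrict_ball_real]
  refine Measure.restrict_mono (ball_subset_ball' ?_) le_rfl
  rw [dist_comm, dist_zero_right]
  exact h

/-- The kicked drift `θ ↦ e^{iε(v + θ)} · u` is continuous in the momentum `θ`. -/
theorem continuous_circleKickDrift (ε v : ℝ) (u : Circle) :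
    Continuous fun θ : ℝ => Circle.exp (ε * (v + θ)) * u :=
  (Circle.exp.continuous.comp (continuous_const.mul (continuous_const.add continuous_id))).mul
    continuous_const

/-- … hence measurable. -/
theorem measurable_circleKickDrift (ε v : ℝ) (u : Circle) :
    Measurable fun θ : ℝ => Circle.exp (ε * (v + θ)) * u :=
  (continuous_circleKickDrift ε v u).measurable

/-- **One kicked exponential drift of an interval-uniform momentum dominates `(2π/ε) ·` Haar
measure on `U(1)`, uniformly in the kick and in the frozen link.**  For `ε > 0`, `π/ε + |v| ≤ R` and
every `u ∈ U(1)`: `(2π/ε) • Haar ≤ (dθ|_{|θ|<R}) ∘ (θ ↦ e^{iε(v+θ)}·u)⁻¹`. -/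
theorem smul_haarProbability_circle_le_map_kickDrift {ε : ℝ} (hε : 0 < ε) {v R : ℝ}
    (hR : Real.pi / ε + ‖v‖ ≤ R) (u : Circle) :
    ENNReal.ofReal (2 * Real.pi / ε) • haarProbability Circle ≤
      (volume.restrict (ball (0 : ℝ) R)).map (fun θ : ℝ => Circle.exp (ε * (v + θ)) * u) := by
  have hcomp : (fun θ : ℝ => Circle.exp (ε * (v + θ)) * u) =
      (fun g : Circle => g * u) ∘ ((fun θ : ℝ => Circle.exp (ε * θ)) ∘ fun θ : ℝ => v + θ) := rfl
  have hm1 : Measurable fun θ : ℝ => Circle.exp (ε * θ) :=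
    Circle.exp.continuous.measurable.comp (measurable_const_mul ε)
  have hm2 : Measurable fun g : Circle => g * u := measurable_mul_const u
  rw [hcomp, ← Measure.map_map hm2 (hm1.comp (measurable_const_add v)),
    ← Measure.map_map hm1 (measurable_const_add v)]
  calc ENNReal.ofReal (2 * Real.pi / ε) • haarProbability Circle
      = (ENNReal.ofReal (2 * Real.pi / ε) • haarProbability Circle).map (fun g : Circle => g * u) := by
        rw [Measure.map_smul, map_mul_right_eq_self]
    _ ≤ ((volume.restrict (ball (0 : ℝ) (Real.pi / ε))).map (fun θ : ℝ => Circle.exp (ε * θ))).map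
          (fun g : Circle => g * u) :=
        Measure.map_mono (smul_haarProbability_circle_le_map_exp_mul hε) hm2
    _ ≤ (((volume.restrict (ball (0 : ℝ) R)).map (fun θ : ℝ => v + θ)).map
          (fun θ : ℝ => Circle.exp (ε * θ))).map (fun g : Circle => g * u) :=
        Measure.map_mono (Measure.map_mono (restrict_ball_le_map_add_left_real hR) hm1) hm2

end Summit.Ventures.LatticeQCDFlow.Exactness
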